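import Summits.ValiantsHypothesis.ValiantsHypothesis.Theses.KPlusLogSqLaw
import Summits.ValiantsHypothesis.ValiantsHypothesis.Theorems.KPlusLogSqLawTropicalBRegimeCollapse
import Summits.ValiantsHypothesis.ValiantsHypothesis.Theorems.KPlusLogSqLawTropicalBStaticPorts

/-!
# Route «KPlusLogSqLaw», crux `TropicalB` (stmt-ValiantsHypothesis-19771) — the crux as a statement about PLAIN parametric
# assignment: the STATIC DIAGONAL

HONEST FRAMING.  Helper file for the registered stubs `stub_tropThin` / `stub_tropFat` of `Cruxes/TropicalB/Lines/birth.lean`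
(crux `TropicalB`, route `KPlusLogSqLaw`; cell `pub-symmetroid`, seat val-sym-trop-p4 (g2), 2026-08-26).  An EQUIVALENCE between
open statements; nothing is asserted about `TropicalB`, `Lifting`, `MatrixDescartes` (stmt-ValiantsHypothesis-18050) or VP ≠ VNP.

The companion file `…TropicalBRegimeCollapse` makes the crux the one-parameter diagonal law
`∃ C, ∀ s, TropRootLawAt (2^s) (s^2) (2^(C·s^2))` (`tropicalB_iff_diagonal`).  Composing with the STATIC PORT EMBEDDING of seat
val-sym-trop-p4 (g0) (`TropicalCensus.tropRootLawAt_of_static_ports : TropRootLawAtStatic (m·K) K B → TropRootLawAt m K B`) and the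
trivial direction `tropRootLawAtStatic_of_tropRootLawAt`, the crux becomes a statement about STATIC designs only — one present
class per entry, i.e. LINEAR parametric assignment `max_σ ∑_i (a_{σ(i) i} + θ·b_{σ(i) i})` whose slope matrix `b` takes at most `K`
distinct values (the plane shadows of the Birkhoff polytope along an `x`-functional with few distinct entries):

* `tropicalB_iff_staticDiagonal` — `TropicalB ↔ ∃ C, ∀ s, TropRootLawAtStatic (2^s · s^2) (s^2) (2^(C·s^2))`.

READING.  With `n = s²·2^s` nodes (`⌊log₂ n⌋ = s + O(log s)`): «a linear parametric assignment instance on `n` nodes whose slope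
matrix has at most `log₂² n` distinct entries has at most `2^(O(log² n))` sign-alternating breakpoints» is EQUIVALENT to the crux
(up to the constants) — Hrubeš–Yehudayoff's Open Problem 1 (shadow complexity of `DS_n`, `2^{Ω(log² n)} ≤ σ(DS_n) ≤ 2^{O(n)}`)
restricted to `x`-functionals with `≤ log₂² n` distinct entry values, on its small side.
[folklore] bookkeeping over landed tree theorems; the statements themselves are conjectures of the cell (no citation exists).
-/

set_option linter.dupNamespace false
set_option autoImplicit false

namespace Summit.ValiantsHypothesis.ValiantsHypothesis.Theorems.KPlusLogSqLaw

open Summit.ValiantsHypothesis.ValiantsHypothesis.Theorems.LacunarySymmetroidMatrixDescartes.TropicalCensus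
open Summit.ValiantsHypothesis.ValiantsHypothesis.Theses.KPlusLogSqLaw (TropicalB)

/-- `⌊log₂ (2^s · s²)⌋² ≤ 49 s²` (`⌊log₂ (2^s s²)⌋ ≤ s + 2⌊log₂ s⌋ + 3 ≤ 3s + 3`, and the left side vanishes at `s = 0`). [folklore] -/
theorem logsq_two_pow_mul_sq_le (s : ℕ) : Nat.log 2 (2 ^ s * s ^ 2) ^ 2 ≤ 49 * s ^ 2 := by
  rcases Nat.eq_zero_or_pos s with rfl | hs
  · simp
  have h1 : Nat.log 2 (2 ^ s * s ^ 2) < s + Nat.log 2 (s ^ 2) + 2 := by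
    have := log_two_mul_lt (2 ^ s) (s ^ 2)
    rwa [Nat.log_pow one_lt_two] at this
  have h2 : Nat.log 2 (s ^ 2) < 2 * Nat.log 2 s + 2 := by
    have := log_two_mul_lt s s
    rw [sq]; omega
  have h3 : Nat.log 2 s < s := Nat.log_lt_self 2 (by omega)
  have h4 : Nat.log 2 (2 ^ s * s ^ 2) ≤ 7 * s := by omega
  calc Nat.log 2 (2 ^ s * s ^ 2) ^ 2 ≤ (7 * s) ^ 2 := Nat.pow_le_pow_left h4 2
    _ = 49 * s ^ 2 := by ring

/-- **TB ↔ the static diagonal.**  `TropicalB` holds iff linear parametric assignment instances (static designs: one present class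
per entry) on `2^s · s²` nodes with at most `s²` slope values have at most `2^(C·s²)` sign-alternating dominant breakpoints:
`TropicalB ↔ ∃ C, ∀ s, TropRootLawAtStatic (2^s · s^2) (s^2) (2^(C·s^2))`.  (`→`: `TropicalB` at the format `(2^s s², s²)`,
`⌊log₂(2^s s²)⌋² ≤ 49 s²`, restricted to static designs; `←`: the static port embedding at `K`-fold size gives the diagonal row
`TropRootLawAt (2^s) (s^2)`, and `tropicalB_iff_diagonal`.) -/
theorem tropicalB_iff_staticDiagonal :
    TropicalB ↔ ∃ C : ℕ, ∀ s : ℕ, TropRootLawAtStatic (2 ^ s * s ^ 2) (s ^ 2) (2 ^ (C * s ^ 2)) := by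
  constructor
  · rintro ⟨C, hC⟩
    refine ⟨50 * C, fun s => tropRootLawAtStatic_of_tropRootLawAt
      (tropRootLawAt_mono (Nat.pow_le_pow_right two_pos ?_) (hC (2 ^ s * s ^ 2) (s ^ 2)))⟩
    have h := logsq_two_pow_mul_sq_le s
    nlinarith
  · rintro ⟨C, hC⟩
    exact tropicalB_iff_diagonal.mpr ⟨C, fun s => tropRootLawAt_of_static_ports (2 ^ s) (s ^ 2) _ (hC s)⟩

end Summit.ValiantsHypothesis.ValiantsHypothesis.Theorems.KPlusLogSqLaw
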